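import Summits.HodgeConjecture.HodgeConjecture.Theorems.Ring2AbelianAllStandardAPencilsHomNum
import Summits.HodgeConjecture.HodgeConjecture.Theorems.Ring2AbelianAllAndreStandardANumerical
import HarnessLib

/-!
# Ring 2 · §AbelianAll (seat `ab-andre-1`), XIV-e — `A(X, η) ⟺ D(X)` ON THE REAL CARRIERS, fact-free: the `A`-nodes
# of part XIV and the `hom ≡ num` hypotheses of part XIV-d are ONE node class (one-sided above the middle ⟺ two-sided
# in all codimensions ⟺ `A` for every polarisation class ⟺ `A` for one Kähler class); `D` of a variety follows from
# the Hodge conjecture FOR THAT VARIETY with no named fact; the pencil nodes and the first open rung `d = 4` as `iff`s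

HONEST FRAMING: research route, not a corollary; conditional on HC_CM plus one named minimal statement.
(Cell line: research route conditional on HC_CM; not a corollary; Q11.4-sentence-2 already refuted in dim ≥ 3.)
Nothing in this file proves a case of the Hodge conjecture for an abelian variety, a case of `A(X)`, `B(X)` or `D(X)`
in an open range, or that any node is minimal or strictly weaker than another open node. `HC_CM` =
`Theses.RankFourFaces.CMAbelianHodge` and `HC_AV` = `Theses.PadicSemiregularLift.HodgeAbelianVarieties` are BINDERS
wherever they occur; item `Theses.RankFourFaces.CMToAbelian` (stmt-16267) stays OPEN. No definition, no named fact,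
no sorry: theorems only, over the tree's real carriers `H•(X(ℂ); ℂ)`, `Nᵖ H²ᵖ = HodgeTheory.algebraicClasses`,
`HodgeTheory.StandardConjectureA`, `HodgeTheory.KaehlerRationalDatum`.

## Why this file (count once: two letters, ONE node)

Part XIV (this seat) filed the `A`-letter nodes A_pen∀ = `CompactAbelianPencilStandardA`, A_pen^CM =
`CMPointedPencilStandardA` and their graded pieces `StandardACompactPencilsAtRelDim d`,
`StandardACMPointedPencilsAtRelDim d`; part XIV-d proved Kleiman's `D ⇒ A` on the carriers in ONE-SIDED form
(`standardConjectureA_of_homNum`: for `p + q = n`, `2 ≤ p < q`, an element of `N^q H^{2q}(X(ℂ); ℂ)` cup-orthogonal to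
`Nᵖ H²ᵖ` is zero `⟹ A(X, η)` for every polarisation class `η`). Seat ab-andre-2 proved the converse `A ⇒ D` (part
XVIII-d `nondegenerate_algebraicClasses_of_standardConjectureA`: `A(X, η)` for every polarisation class — in fact for the
Kähler class of one Kähler–rational datum — makes the cup pairing `Nᵖ × N^q → H²ⁿ` non-degenerate ON BOTH SIDES for ALL
`p + q = n`, by "primitive components of algebraic classes are algebraic" and the second Hodge–Riemann relation) and
`HC ⇒ D` (part XVIII-b `nondegenerate_algebraicClasses_of_hodge`: the Hodge conjecture for `X` in degrees `2p`, `2q`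
gives the same). This file only COMPOSES the three, so that (i) the census carries ONE node where print has one
statement — "it is well known that `A` is equivalent to the statement that numerical equivalence is equal to
homological equivalence" (characteristic `0`; Kleiman 1968 §3, Kleiman 1994 Thm. 4-1 / Prop. 5-1, Lieberman 1968) —
instead of an `A`-letter node (part XIV) and a `D`-letter hypothesis (part XIV-d) counted twice; (ii) the `D`-letter
hypotheses of part XIV-d receive their ON-PATH certificate `HodgeConjecture ⟹ D` with NO named fact (parts I, XIV
certify the `⋆_L`- and `A`-nodes; brief item (iii), "for each target, `<target>_of_HodgeConjecture`"); (iii) the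
quantifier "for every polarisation class `η`" in the part-XIV nodes is shown immaterial: `A(X, κ)` for the Kähler
class `κ` of ONE Kähler–rational datum gives `A(X, η)` for EVERY polarisation class (Kleiman: `A(X, L)` is independent
of `L` in characteristic `0`, because it is equivalent to `D(X)`).

## What is proved (all fact-free; `X` smooth complex projective of dimension `n`; `𝒳` the total space, of dimension
`d + 1`, of a compact pencil of abelian `d`-folds)

§1 `standardConjectureA_forall_iff_homNum` (`(∀ η pol, A(X, η)) ⟺` one-sided `hom ≡ num` for `2 ≤ p < q`),
`standardConjectureA_forall_iff_nondegenerate` (`⟺` two-sided non-degeneracy of `Nᵖ × N^q → H²ⁿ` for all `p + q = n`: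
`D(X) ⊗ ℂ` on the carriers), `homNum_iff_nondegenerate` (one-sided above the middle `⟺` two-sided everywhere),
`standardConjectureA_of_kaehlerRationalDatum` / `standardConjectureA_forall_iff_kaehlerRationalDatum` /
`standardConjectureA_forall_iff_exists_kaehlerRationalDatum` (independence of the polarisation), and in dimension `5`
`standardConjectureA_five_forall_iff_homNum_surfaces` (`⟺` the single vanishing statement for algebraic surface
classes of part XIV-d). ON-PATH: `nondegenerate_algebraicClasses_of_hodgeConjectureFor` (`HC(X) ⟹ D(X)` on the
carriers, no named fact).
§2 Pencils: `standardACompactPencilsAtRelDim_iff_homNum`, `…_iff_nondegenerate`, the CM-pointed twins, the nodes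
`compactAbelianPencilStandardA_iff_homNum` / `…_iff_nondegenerate`, `cmPointedPencilStandardA_iff_homNum`, the rung
`standardACompactPencilsAtRelDim_four_iff_homNum_surfaces` (+ CM twin), and ON-PATH
`nondegenerateCompactPencil_of_hodgeConjecture` (`HodgeConjecture ⟹` two-sided `hom ≡ num` on every compact total
space, fact-free), `nondegenerateCompactPencil_of_compactAbelianPencilLefschetz` ((5∀) `⟹` the same, fact-free).

## What is NOT claimed

No instance of `A`, `D` or `hom ≡ num` in an open range is proved (for `dim X ≤ 4` none is needed: part XIV-c and
seat ab-andre-2's part XVIII-i); `D(X)` is spoken of only through its complexified cup-pairing form on the carriers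
(the tree has no separate carrier for numerical equivalence of `ℚ`-cycles; both spans and the pairing are defined
over `ℚ`); Tankeev's theorems (Zbl 1157.14002, Zbl 1075.14004) are not typed or used (texts wanted); nothing is
claimed minimal or strictly weaker than (5); `HC_AV ⟹` any node is NOT claimed; `HC_CM` is a binder.

## References

* [Kleiman1968AlgebraicCycles] S. Kleiman, Algebraic cycles and the Weil conjectures, in: Dix exposés sur la
  cohomologie des schémas (1968), §3: Thm. 3.5 (`D ⇒ A`), Prop. 3.8, Cor. 3.9 (`A ∧` Hodge index `⇒ D`).
* [Kleiman1994StandardConjectures] S. Kleiman, The standard conjectures, PSPM 55.1 (1994), Thm. 4-1, Prop. 5-1.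
* [Grothendieck1968] A. Grothendieck, Standard conjectures on algebraic cycles (Bombay 1968), §3 p. 196
  (`A(X)`, `D(X)`; "`B(X) ⇒ A(X)`").
* [Lieberman1968] D. I. Lieberman, Numerical and homological equivalence of algebraic cycles on Hodge manifolds,
  Amer. J. Math. 90 (1968) 366–374.
* [VoisinHodgeI2002] C. Voisin, Hodge Theory and Complex Algebraic Geometry I, §6.3.2 Thm. 6.32, Thm. 11.30.
* [VoisinHodgeII2003] C. Voisin, Hodge Theory and Complex Algebraic Geometry II, §9.2.4 Prop. 9.20.
* [Andre1996Motifs] Y. André, Publ. Math. IHÉS 83 (1996), §6.3 Lemme 6.3.1 (p. 31), Remarque 2 (p. 33).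
* [Milne2020HodgeClassesAV] J. S. Milne, Hodge classes on abelian varieties (2020), Prop. 1 (p. 7), Rem. 5.
* Y. André, Non-abelian Rees construction and pure motives, arXiv:2601.21052 (2026, preprint), §4.4.1 (`D` of the
  total space).
-/

noncomputable section

set_option linter.dupNamespace false

namespace Summit.HodgeConjecture.HodgeConjecture.Ring2.AbelianAll

open CategoryTheory AlgebraicGeometry
open Literature.AlgebraicGeometry Literature.AlgebraicGeometry.Motives
open Literature.AlgebraicGeometry.HodgeTheory
open Literature.AlgebraicTopology.SingularHomology Literature.Geometry.Kaehler
open Literature.AlgebraicGeometry.Deligne1982 (cmLocus)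
open Summit.HodgeConjecture.HodgeConjecture
open Summit.HodgeConjecture.HodgeConjecture.Theses

/-! ## §1 `A(X, η) ⟺ D(X)` on the real carriers of one variety -/

section RealCarriers

variable {n : ℕ} {X : SchemeOver ℂ}

/-- **`A ⟺ D`, one-sided form (Kleiman 1968 Thm. 3.5 with Prop. 3.8 / Cor. 3.9; Kleiman 1994 Thm. 4-1, Prop. 5-1).**
For `X` smooth complex projective of dimension `n`: `A(X, η)` holds for every polarisation class `η` IFF for all
`p + q = n` with `2 ≤ p < q`, every `y ∈ N^q H^{2q}(X(ℂ); ℂ)` with `x ∪ y = 0` for all `x ∈ Nᵖ H²ᵖ(X(ℂ); ℂ)` is zero.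
(`⟸` is part XIV-d `standardConjectureA_of_homNum`; `⟹` is seat ab-andre-2's part XVIII-d
`nondegenerate_algebraicClasses_of_standardConjectureA`, right half.) Fact-free.
[cite: Kleiman1968AlgebraicCycles, §3 Thm. 3.5, Prop. 3.8, Cor. 3.9] [cite: Kleiman1994StandardConjectures, Thm. 4-1 and Prop. 5-1]
[cite: Grothendieck1968, §3 p. 196 (A(X), D(X))] -/
theorem standardConjectureA_forall_iff_homNum (hX : IsSmoothProjective n X) :
    (∀ η : complexBetti X 2, IsPolarizationClass n X η → StandardConjectureA n X η) ↔
      ∀ (p q : ℕ) (hpq : p + q = n) (_ : 2 ≤ p) (_ : p < q), ∀ y ∈ algebraicClasses X q,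
        (∀ x ∈ algebraicClasses X p, cupProduct (show 2 * p + 2 * q = 2 * n by omega) x y = 0) → y = 0 :=
  ⟨fun hA _ _ hpq _ _ y hy h ↦ (nondegenerate_algebraicClasses_of_standardConjectureA hX hA hpq).2 y hy h,
    fun hD _ hη ↦ standardConjectureA_of_homNum hX hη hD⟩

/-- **`A ⟺ D`, two-sided form: `A(X, η)` for every polarisation class IFF the cup pairing
`Nᵖ H²ᵖ(X(ℂ); ℂ) × N^q H^{2q}(X(ℂ); ℂ) → H²ⁿ(X(ℂ); ℂ)` is non-degenerate on both sides for all `p + q = n`** — the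
complexification of Grothendieck's `D(X)` (numerical ≡ homological equivalence for `ℚ`-cycles, all codimensions) on
the tree's carriers. Fact-free. [cite: Kleiman1968AlgebraicCycles, §3 Thm. 3.5, Prop. 3.8, Cor. 3.9]
[cite: Kleiman1994StandardConjectures, Thm. 4-1 and Prop. 5-1] [cite: Grothendieck1968, §3 p. 196 (A(X), D(X))] -/
theorem standardConjectureA_forall_iff_nondegenerate (hX : IsSmoothProjective n X) :
    (∀ η : complexBetti X 2, IsPolarizationClass n X η → StandardConjectureA n X η) ↔
      ∀ (p q : ℕ) (hpq : p + q = n),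
        (∀ ξ ∈ algebraicClasses X p,
            (∀ b ∈ algebraicClasses X q, cupProduct (show 2 * p + 2 * q = 2 * n by omega) ξ b = 0) → ξ = 0) ∧
          (∀ b ∈ algebraicClasses X q,
            (∀ ξ ∈ algebraicClasses X p, cupProduct (show 2 * p + 2 * q = 2 * n by omega) ξ b = 0) → b = 0) :=
  ⟨fun hA _ _ hpq ↦ nondegenerate_algebraicClasses_of_standardConjectureA hX hA hpq,
    fun hD _ hη ↦ standardConjectureA_of_homNum hX hη fun p q hpq _ _ ↦ (hD p q hpq).2⟩

/-- **One-sided `hom ≡ num` above the middle ⟺ two-sided `hom ≡ num` in all codimensions** (both being equivalent to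
`A` for all polarisation classes): the sharp hypothesis of part XIV-d and `D(X) ⊗ ℂ` say the same on a smooth complex
projective variety. Fact-free. [cite: Kleiman1968AlgebraicCycles, §3 Thm. 3.5, Prop. 3.8, Cor. 3.9]
[cite: Lieberman1968, main theorem] -/
theorem homNum_iff_nondegenerate (hX : IsSmoothProjective n X) :
    (∀ (p q : ℕ) (hpq : p + q = n) (_ : 2 ≤ p) (_ : p < q), ∀ y ∈ algebraicClasses X q,
        (∀ x ∈ algebraicClasses X p, cupProduct (show 2 * p + 2 * q = 2 * n by omega) x y = 0) → y = 0) ↔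
      ∀ (p q : ℕ) (hpq : p + q = n),
        (∀ ξ ∈ algebraicClasses X p,
            (∀ b ∈ algebraicClasses X q, cupProduct (show 2 * p + 2 * q = 2 * n by omega) ξ b = 0) → ξ = 0) ∧
          (∀ b ∈ algebraicClasses X q,
            (∀ ξ ∈ algebraicClasses X p, cupProduct (show 2 * p + 2 * q = 2 * n by omega) ξ b = 0) → b = 0) :=
  (standardConjectureA_forall_iff_homNum hX).symm.trans (standardConjectureA_forall_iff_nondegenerate hX)

/-- **Independence of the polarisation (Kleiman): `A(X, κ)` for the Kähler class `κ` of ONE Kähler–rational datum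
gives `A(X, η)` for EVERY polarisation class `η`** — through `D`: part XVIII-d's `A(X, κ) ⇒ D(X)` needs `A` only for
`κ`, and part XIV-d's `D ⇒ A(X, η)` serves every `η`. Fact-free. [cite: Kleiman1968AlgebraicCycles, §3 Thm. 3.5, Cor. 3.9]
[cite: Kleiman1994StandardConjectures, Thm. 4-1] [cite: VoisinHodgeI2002, §6.3.2 Thm. 6.32 and Thm. 11.30] -/
theorem standardConjectureA_of_kaehlerRationalDatum (hX : IsSmoothProjective n X) (D : KaehlerRationalDatum n X)
    (hA : StandardConjectureA n X D.Hη) {η : complexBetti X 2} (hη : IsPolarizationClass n X η) :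
    StandardConjectureA n X η :=
  standardConjectureA_of_homNum hX hη fun _ _ hpq _ _ _ hy h ↦
    eq_zero_of_forall_cupProduct_algebraic_eq_zero_of_standardConjectureA' hX D hA hpq hy h

/-- `A(X, η)` for every polarisation class IFF `A(X, κ_D)` for every Kähler–rational datum `D` (whose Kähler class is a
polarisation class by Lefschetz `(1,1)`, part XVIII-d `isPolarizationClass_Hη`). Fact-free.
[cite: Kleiman1994StandardConjectures, Thm. 4-1] [cite: VoisinHodgeI2002, Thm. 11.30 and §7.1.2] -/
theorem standardConjectureA_forall_iff_kaehlerRationalDatum (hX : IsSmoothProjective n X) :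
    (∀ η : complexBetti X 2, IsPolarizationClass n X η → StandardConjectureA n X η) ↔
      ∀ D : KaehlerRationalDatum n X, StandardConjectureA n X D.Hη :=
  ⟨fun h D ↦ h _ (isPolarizationClass_Hη hX D), fun h η hη ↦ by
    obtain ⟨D⟩ := nonempty_kaehlerRationalDatum hX
    exact standardConjectureA_of_kaehlerRationalDatum hX D (h D) hη⟩

/-- `A(X, η)` for every polarisation class IFF `A(X, κ_D)` for SOME Kähler–rational datum `D` (one exists:
`nonempty_kaehlerRationalDatum`). Fact-free. [cite: Kleiman1994StandardConjectures, Thm. 4-1]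
[cite: VoisinHodgeI2002, Thm. 11.30 and §7.1.2] -/
theorem standardConjectureA_forall_iff_exists_kaehlerRationalDatum (hX : IsSmoothProjective n X) :
    (∀ η : complexBetti X 2, IsPolarizationClass n X η → StandardConjectureA n X η) ↔
      ∃ D : KaehlerRationalDatum n X, StandardConjectureA n X D.Hη :=
  ⟨fun h ↦ by
    obtain ⟨D⟩ := nonempty_kaehlerRationalDatum hX
    exact ⟨D, h _ (isPolarizationClass_Hη hX D)⟩,
    fun ⟨D, hD⟩ η hη ↦ standardConjectureA_of_kaehlerRationalDatum hX D hD hη⟩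

/-- **Dimension `5`**: `A(X, η)` for every polarisation class of a smooth complex projective FIVEFOLD IFF every element
of `N³ H⁶(X(ℂ); ℂ)` (span of the algebraic surface classes) cup-orthogonal to `N² H⁴(X(ℂ); ℂ)` is zero (the only
instance of `hom ≡ num` with content in dimension `5`; parts XIV-c, XIV-d). Fact-free.
[cite: Kleiman1968AlgebraicCycles, §3 Thm. 3.5, Cor. 3.9] [cite: Grothendieck1968, §3 p. 196 (A(X), D(X))] -/
theorem standardConjectureA_five_forall_iff_homNum_surfaces (hX : IsSmoothProjective 5 X) :
    (∀ η : complexBetti X 2, IsPolarizationClass 5 X η → StandardConjectureA 5 X η) ↔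
      ∀ y ∈ algebraicClasses X 3,
        (∀ x ∈ algebraicClasses X 2, cupProduct (show 2 * 2 + 2 * 3 = 2 * 5 by omega) x y = 0) → y = 0 :=
  ⟨fun hA y hy h ↦ (nondegenerate_algebraicClasses_of_standardConjectureA hX hA (show 2 + 3 = 5 by norm_num)).2 y hy h,
    fun hD _ hη ↦ standardConjectureA_five_of_homNum_surfaces hX hη hD⟩

/-- **ON-PATH, FACT-FREE: `HC(X) ⟹ D(X)` on the carriers.** The Hodge conjecture for `X` (all codimensions) makes
the cup pairing `Nᵖ × N^q → H²ⁿ` (`p + q = n`) non-degenerate on both sides (seat ab-andre-2's part XVIII-b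
`nondegenerate_algebraicClasses_of_hodge`, from Hodge–Riemann; equivalently `HC ⟹ A` of the tree's
`standardConjectureA_of_hodgeConjectureFor` followed by `A ⟹ D`). No named fact. [cite: Kleiman1968AlgebraicCycles, §3]
[cite: Lieberman1968, main theorem] [cite: VoisinHodgeI2002, §6.3.2 Thm. 6.32] -/
theorem nondegenerate_algebraicClasses_of_hodgeConjectureFor (hX : IsSmoothProjective n X)
    (h : HodgeConjectureFor n X) {p q : ℕ} (hpq : p + q = n) :
    (∀ ξ ∈ algebraicClasses X p,
        (∀ b ∈ algebraicClasses X q, cupProduct (show 2 * p + 2 * q = 2 * n by omega) ξ b = 0) → ξ = 0) ∧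
      (∀ b ∈ algebraicClasses X q,
        (∀ ξ ∈ algebraicClasses X p, cupProduct (show 2 * p + 2 * q = 2 * n by omega) ξ b = 0) → b = 0) :=
  nondegenerate_algebraicClasses_of_hodge hX hpq (fun c hc hpp ↦ h.2 p c hc hpp) (fun c hc hqq ↦ h.2 q c hc hqq)

end RealCarriers

/-! ## §2 The pencil nodes of part XIV as `iff`s with `hom ≡ num` on the total spaces -/

/-- **`(A∀)_d ⟺ hom ≡ num` (one-sided, codimension `q > (d+1)/2` against `p ≥ 2`) on the total space of every compact
pencil of abelian `d`-folds.** (`⟸` part XIV-d `standardACompactPencilsAtRelDim_of_homNum`.) Fact-free.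
[cite: Kleiman1968AlgebraicCycles, §3 Thm. 3.5, Cor. 3.9] [cite: Andre1996Motifs, §6.3 Remarque 2 (p. 33)] -/
theorem standardACompactPencilsAtRelDim_iff_homNum {d : ℕ} :
    StandardACompactPencilsAtRelDim d ↔
      ∀ ⦃𝒳 S : SchemeOver ℂ⦄ (f : 𝒳 ⟶ S), IsCompactAbelianPencil f d →
        ∀ (p q : ℕ) (hpq : p + q = d + 1) (_ : 2 ≤ p) (_ : p < q), ∀ y ∈ algebraicClasses 𝒳 q,
          (∀ x ∈ algebraicClasses 𝒳 p, cupProduct (show 2 * p + 2 * q = 2 * (d + 1) by omega) x y = 0) → y = 0 :=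
  ⟨fun hA _ _ f hf ↦ (standardConjectureA_forall_iff_homNum hf.isSmoothProjective_total).1 (hA f hf),
    standardACompactPencilsAtRelDim_of_homNum⟩

/-- **`(A∀)_d ⟺ D(𝒳) ⊗ ℂ` (two-sided non-degeneracy of `Nᵖ × N^q → H^{2d+2}`, all `p + q = d + 1`) on the total space
of every compact pencil of abelian `d`-folds** — the form of André 2026 §4.4.1 ("conjecture D for the total space",
preprint) and of the print edge reported for Tankeev 2008 (text not consulted). Fact-free.
[cite: Kleiman1968AlgebraicCycles, §3 Thm. 3.5, Cor. 3.9] [cite: Andre1996Motifs, §6.3 Remarque 2 (p. 33)] -/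
theorem standardACompactPencilsAtRelDim_iff_nondegenerate {d : ℕ} :
    StandardACompactPencilsAtRelDim d ↔
      ∀ ⦃𝒳 S : SchemeOver ℂ⦄ (f : 𝒳 ⟶ S), IsCompactAbelianPencil f d → ∀ (p q : ℕ) (hpq : p + q = d + 1),
        (∀ ξ ∈ algebraicClasses 𝒳 p,
            (∀ b ∈ algebraicClasses 𝒳 q, cupProduct (show 2 * p + 2 * q = 2 * (d + 1) by omega) ξ b = 0) → ξ = 0) ∧
          (∀ b ∈ algebraicClasses 𝒳 q,
            (∀ ξ ∈ algebraicClasses 𝒳 p, cupProduct (show 2 * p + 2 * q = 2 * (d + 1) by omega) ξ b = 0) → b = 0) :=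
  ⟨fun hA _ _ f hf ↦ (standardConjectureA_forall_iff_nondegenerate hf.isSmoothProjective_total).1 (hA f hf),
    fun hD _ _ f hf ↦ (standardConjectureA_forall_iff_nondegenerate hf.isSmoothProjective_total).2 (hD f hf)⟩

/-- **`(A^CM)_d ⟺ hom ≡ num` (one-sided) on the total spaces of the CM-pointed compact pencils of abelian `d`-folds.**
(`⟸` part XIV-d `standardACMPointedPencilsAtRelDim_of_homNum`.) Fact-free.
[cite: Kleiman1968AlgebraicCycles, §3 Thm. 3.5, Cor. 3.9] [cite: Andre1996Motifs, Lemme 6.3.1 (ii) (p. 31)] -/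
theorem standardACMPointedPencilsAtRelDim_iff_homNum {d : ℕ} :
    StandardACMPointedPencilsAtRelDim d ↔
      ∀ ⦃𝒳 S : SchemeOver ℂ⦄ (f : 𝒳 ⟶ S), IsCompactAbelianPencil f d → (cmLocus f d).Nonempty →
        ∀ (p q : ℕ) (hpq : p + q = d + 1) (_ : 2 ≤ p) (_ : p < q), ∀ y ∈ algebraicClasses 𝒳 q,
          (∀ x ∈ algebraicClasses 𝒳 p, cupProduct (show 2 * p + 2 * q = 2 * (d + 1) by omega) x y = 0) → y = 0 :=
  ⟨fun hA _ _ f hf hCM ↦ (standardConjectureA_forall_iff_homNum hf.isSmoothProjective_total).1 (hA f hf hCM),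
    standardACMPointedPencilsAtRelDim_of_homNum⟩

/-- **`(A^CM)_d ⟺ D(𝒳) ⊗ ℂ` (two-sided, all `p + q = d + 1`) on the total spaces of the CM-pointed compact pencils of
abelian `d`-folds.** Fact-free. [cite: Kleiman1968AlgebraicCycles, §3 Thm. 3.5, Cor. 3.9]
[cite: Andre1996Motifs, Lemme 6.3.1 (ii) (p. 31)] -/
theorem standardACMPointedPencilsAtRelDim_iff_nondegenerate {d : ℕ} :
    StandardACMPointedPencilsAtRelDim d ↔
      ∀ ⦃𝒳 S : SchemeOver ℂ⦄ (f : 𝒳 ⟶ S), IsCompactAbelianPencil f d → (cmLocus f d).Nonempty →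
        ∀ (p q : ℕ) (hpq : p + q = d + 1),
          (∀ ξ ∈ algebraicClasses 𝒳 p,
              (∀ b ∈ algebraicClasses 𝒳 q, cupProduct (show 2 * p + 2 * q = 2 * (d + 1) by omega) ξ b = 0) → ξ = 0) ∧
            (∀ b ∈ algebraicClasses 𝒳 q,
              (∀ ξ ∈ algebraicClasses 𝒳 p, cupProduct (show 2 * p + 2 * q = 2 * (d + 1) by omega) ξ b = 0) → b = 0) :=
  ⟨fun hA _ _ f hf hCM ↦ (standardConjectureA_forall_iff_nondegenerate hf.isSmoothProjective_total).1 (hA f hf hCM),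
    fun hD _ _ f hf hCM ↦ (standardConjectureA_forall_iff_nondegenerate hf.isSmoothProjective_total).2 (hD f hf hCM)⟩

/-- **A_pen∀ ⟺ hom ≡ num (one-sided) on the total spaces of all compact abelian pencils.** (`⟸` part XIV-d
`compactAbelianPencilStandardA_of_homNum`.) Fact-free. [cite: Kleiman1968AlgebraicCycles, §3 Thm. 3.5, Cor. 3.9]
[cite: Andre1996Motifs, §6.3 Remarque 2 (p. 33)] -/
theorem compactAbelianPencilStandardA_iff_homNum :
    CompactAbelianPencilStandardA ↔
      ∀ ⦃d : ℕ⦄ ⦃𝒳 S : SchemeOver ℂ⦄ (f : 𝒳 ⟶ S), IsCompactAbelianPencil f d →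
        ∀ (p q : ℕ) (hpq : p + q = d + 1) (_ : 2 ≤ p) (_ : p < q), ∀ y ∈ algebraicClasses 𝒳 q,
          (∀ x ∈ algebraicClasses 𝒳 p, cupProduct (show 2 * p + 2 * q = 2 * (d + 1) by omega) x y = 0) → y = 0 :=
  ⟨fun hA _ _ _ f hf ↦ (standardConjectureA_forall_iff_homNum hf.isSmoothProjective_total).1 (hA f hf),
    compactAbelianPencilStandardA_of_homNum⟩

/-- **A_pen∀ ⟺ D(𝒳) ⊗ ℂ (two-sided) on the total spaces of all compact abelian pencils.** Fact-free.
[cite: Kleiman1968AlgebraicCycles, §3 Thm. 3.5, Cor. 3.9] [cite: Andre1996Motifs, §6.3 Remarque 2 (p. 33)] -/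
theorem compactAbelianPencilStandardA_iff_nondegenerate :
    CompactAbelianPencilStandardA ↔
      ∀ ⦃d : ℕ⦄ ⦃𝒳 S : SchemeOver ℂ⦄ (f : 𝒳 ⟶ S), IsCompactAbelianPencil f d → ∀ (p q : ℕ) (hpq : p + q = d + 1),
        (∀ ξ ∈ algebraicClasses 𝒳 p,
            (∀ b ∈ algebraicClasses 𝒳 q, cupProduct (show 2 * p + 2 * q = 2 * (d + 1) by omega) ξ b = 0) → ξ = 0) ∧
          (∀ b ∈ algebraicClasses 𝒳 q,
            (∀ ξ ∈ algebraicClasses 𝒳 p, cupProduct (show 2 * p + 2 * q = 2 * (d + 1) by omega) ξ b = 0) → b = 0) := by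
  rw [compactAbelianPencilStandardA_iff_forall]
  exact ⟨fun hA d _ _ f hf ↦ standardACompactPencilsAtRelDim_iff_nondegenerate.1 (hA d) f hf,
    fun hD d ↦ standardACompactPencilsAtRelDim_iff_nondegenerate.2 fun _ _ f hf ↦ hD f hf⟩

/-- **A_pen^CM ⟺ hom ≡ num (one-sided) on the total spaces of the CM-pointed compact abelian pencils.** (`⟸` part XIV-d
`cmPointedPencilStandardA_of_homNum`.) Fact-free. [cite: Kleiman1968AlgebraicCycles, §3 Thm. 3.5, Cor. 3.9]
[cite: Andre1996Motifs, Lemme 6.3.1 (ii) (p. 31)] -/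
theorem cmPointedPencilStandardA_iff_homNum :
    CMPointedPencilStandardA ↔
      ∀ ⦃d : ℕ⦄ ⦃𝒳 S : SchemeOver ℂ⦄ (f : 𝒳 ⟶ S), IsCompactAbelianPencil f d → (cmLocus f d).Nonempty →
        ∀ (p q : ℕ) (hpq : p + q = d + 1) (_ : 2 ≤ p) (_ : p < q), ∀ y ∈ algebraicClasses 𝒳 q,
          (∀ x ∈ algebraicClasses 𝒳 p, cupProduct (show 2 * p + 2 * q = 2 * (d + 1) by omega) x y = 0) → y = 0 := by
  rw [cmPointedPencilStandardA_iff_forall]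
  exact ⟨fun hA d _ _ f hf hCM ↦ standardACMPointedPencilsAtRelDim_iff_homNum.1 (hA d) f hf hCM,
    fun hD d ↦ standardACMPointedPencilsAtRelDim_iff_homNum.2 fun _ _ f hf hCM ↦ hD f hf hCM⟩

/-- **The first open rung as an `iff`: `(A∀)_4 ⟺` on the fivefold total space of every compact pencil of abelian
FOURFOLDS, an element of `N³ H⁶(𝒳(ℂ); ℂ)` (span of the algebraic surface classes) cup-orthogonal to `N² H⁴(𝒳(ℂ); ℂ)`
is zero.** (`⟸` part XIV-d `standardACompactPencilsAtRelDim_four_of_homNum_surfaces`; compare part XIV-c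
`standardACompactPencilsAtRelDim_four_iff_surjOn`, the same rung as one surjectivity.) OPEN either way; nothing
asserted. Fact-free. [cite: Kleiman1968AlgebraicCycles, §3 Thm. 3.5, Cor. 3.9] [cite: Andre1996Motifs, §6.3 Remarque 2 (p. 33)] -/
theorem standardACompactPencilsAtRelDim_four_iff_homNum_surfaces :
    StandardACompactPencilsAtRelDim 4 ↔
      ∀ ⦃𝒳 S : SchemeOver ℂ⦄ (f : 𝒳 ⟶ S), IsCompactAbelianPencil f 4 →
        ∀ y ∈ algebraicClasses 𝒳 3,
          (∀ x ∈ algebraicClasses 𝒳 2, cupProduct (show 2 * 2 + 2 * 3 = 2 * 5 by omega) x y = 0) → y = 0 :=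
  ⟨fun hA _ _ f hf ↦ (standardConjectureA_five_forall_iff_homNum_surfaces hf.isSmoothProjective_total).1 (hA f hf),
    standardACompactPencilsAtRelDim_four_of_homNum_surfaces⟩

/-- **`(A^CM)_4 ⟺` the same vanishing statement on the CM-pointed compact pencils of abelian fourfolds only.**
Fact-free. [cite: Kleiman1968AlgebraicCycles, §3 Thm. 3.5, Cor. 3.9] [cite: Andre1996Motifs, Lemme 6.3.1 (ii) (p. 31)] -/
theorem standardACMPointedPencilsAtRelDim_four_iff_homNum_surfaces :
    StandardACMPointedPencilsAtRelDim 4 ↔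
      ∀ ⦃𝒳 S : SchemeOver ℂ⦄ (f : 𝒳 ⟶ S), IsCompactAbelianPencil f 4 → (cmLocus f 4).Nonempty →
        ∀ y ∈ algebraicClasses 𝒳 3,
          (∀ x ∈ algebraicClasses 𝒳 2, cupProduct (show 2 * 2 + 2 * 3 = 2 * 5 by omega) x y = 0) → y = 0 :=
  ⟨fun hA _ _ f hf hCM ↦
      (standardConjectureA_five_forall_iff_homNum_surfaces hf.isSmoothProjective_total).1 (hA f hf hCM),
    standardACMPointedPencilsAtRelDim_four_of_homNum_surfaces⟩

/-- **ON-PATH (C6), FACT-FREE: `HodgeConjecture ⟹ D(𝒳) ⊗ ℂ` on the total space of every compact abelian pencil** —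
the Hodge conjecture for the total space `𝒳` itself (dimension `d + 1`) gives two-sided non-degeneracy of
`Nᵖ × N^q → H^{2d+2}` for all `p + q = d + 1`; hence every `hom ≡ num` hypothesis of parts XIV-d / XIV-e follows from
the Hodge conjecture with NO named fact. [cite: Kleiman1968AlgebraicCycles, §3] [cite: Lieberman1968, main theorem] -/
theorem nondegenerateCompactPencil_of_hodgeConjecture (h : _root_.HodgeConjecture) {d : ℕ} {𝒳 S : SchemeOver ℂ}
    {f : 𝒳 ⟶ S} (hf : IsCompactAbelianPencil f d) {p q : ℕ} (hpq : p + q = d + 1) :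
    (∀ ξ ∈ algebraicClasses 𝒳 p,
        (∀ b ∈ algebraicClasses 𝒳 q, cupProduct (show 2 * p + 2 * q = 2 * (d + 1) by omega) ξ b = 0) → ξ = 0) ∧
      (∀ b ∈ algebraicClasses 𝒳 q,
        (∀ ξ ∈ algebraicClasses 𝒳 p, cupProduct (show 2 * p + 2 * q = 2 * (d + 1) by omega) ξ b = 0) → b = 0) :=
  nondegenerate_algebraicClasses_of_hodgeConjectureFor hf.isSmoothProjective_total (h hf.isSmoothProjective_total) hpq

/-- ON-PATH for the one-sided hypotheses of part XIV-d: `HodgeConjecture ⟹ hom ≡ num` (one-sided, all relative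
dimensions, all compact abelian pencils), fact-free. [cite: Kleiman1968AlgebraicCycles, §3] -/
theorem homNumCompactPencils_of_hodgeConjecture (h : _root_.HodgeConjecture) ⦃d : ℕ⦄ ⦃𝒳 S : SchemeOver ℂ⦄
    (f : 𝒳 ⟶ S) (hf : IsCompactAbelianPencil f d) (p q : ℕ) (hpq : p + q = d + 1) (_ : 2 ≤ p) (_ : p < q) :
    ∀ y ∈ algebraicClasses 𝒳 q,
      (∀ x ∈ algebraicClasses 𝒳 p, cupProduct (show 2 * p + 2 * q = 2 * (d + 1) by omega) x y = 0) → y = 0 :=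
  (nondegenerateCompactPencil_of_hodgeConjecture h hf hpq).2

/-- **(5∀) `⟹ D(𝒳) ⊗ ℂ` on every compact total space, fact-free**: André's `⋆_L`-node `CompactAbelianPencilLefschetz`
gives A_pen∀ (part XIV `compactAbelianPencilStandardA_of_compactAbelianPencilLefschetz`, Grothendieck's `B ⇒ A`), hence
two-sided `hom ≡ num` (this file). The order of the census is `(5∀) ⟹ A_pen∀ ⟺ D_pen∀`; no converse is claimed.
[cite: Grothendieck1968, §3 p. 196 (B(X) ⇒ A(X))] [cite: Andre1996Motifs, §6.3 Remarque 2 (p. 33)] -/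
theorem nondegenerateCompactPencil_of_compactAbelianPencilLefschetz (hB : CompactAbelianPencilLefschetz) {d : ℕ}
    {𝒳 S : SchemeOver ℂ} {f : 𝒳 ⟶ S} (hf : IsCompactAbelianPencil f d) {p q : ℕ} (hpq : p + q = d + 1) :
    (∀ ξ ∈ algebraicClasses 𝒳 p,
        (∀ b ∈ algebraicClasses 𝒳 q, cupProduct (show 2 * p + 2 * q = 2 * (d + 1) by omega) ξ b = 0) → ξ = 0) ∧
      (∀ b ∈ algebraicClasses 𝒳 q,
        (∀ ξ ∈ algebraicClasses 𝒳 p, cupProduct (show 2 * p + 2 * q = 2 * (d + 1) by omega) ξ b = 0) → b = 0) :=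
  compactAbelianPencilStandardA_iff_nondegenerate.1 (compactAbelianPencilStandardA_of_compactAbelianPencilLefschetz hB)
    f hf p q hpq

/-- ON-PATH summary for this file: under the Hodge conjecture every `iff` above has both sides TRUE (left sides by part
XIV `standardANodes_of_hodgeConjecture`), with NO named fact. [folklore] -/
theorem homNumNodes_of_hodgeConjecture (h : _root_.HodgeConjecture) :
    (∀ ⦃d : ℕ⦄ ⦃𝒳 S : SchemeOver ℂ⦄ (f : 𝒳 ⟶ S), IsCompactAbelianPencil f d →
        ∀ (p q : ℕ) (hpq : p + q = d + 1) (_ : 2 ≤ p) (_ : p < q), ∀ y ∈ algebraicClasses 𝒳 q,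
          (∀ x ∈ algebraicClasses 𝒳 p, cupProduct (show 2 * p + 2 * q = 2 * (d + 1) by omega) x y = 0) → y = 0) ∧
      (∀ ⦃d : ℕ⦄ ⦃𝒳 S : SchemeOver ℂ⦄ (f : 𝒳 ⟶ S), IsCompactAbelianPencil f d → ∀ (p q : ℕ) (hpq : p + q = d + 1),
        (∀ ξ ∈ algebraicClasses 𝒳 p,
            (∀ b ∈ algebraicClasses 𝒳 q, cupProduct (show 2 * p + 2 * q = 2 * (d + 1) by omega) ξ b = 0) → ξ = 0) ∧
          (∀ b ∈ algebraicClasses 𝒳 q,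
            (∀ ξ ∈ algebraicClasses 𝒳 p, cupProduct (show 2 * p + 2 * q = 2 * (d + 1) by omega) ξ b = 0) → b = 0)) :=
  ⟨homNumCompactPencils_of_hodgeConjecture h, fun _ _ _ _ hf _ _ hpq ↦ nondegenerateCompactPencil_of_hodgeConjecture h hf hpq⟩

end Summit.HodgeConjecture.HodgeConjecture.Ring2.AbelianAll

end
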